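import Summits.RiemannHypothesis.RiemannHypothesis.Theorems.Splittings.ScrewBridgeFozConsequences
import Summits.RiemannHypothesis.RiemannHypothesis.Theorems.IntegerScrewPivotCriterion
import Summits.RiemannHypothesis.RiemannHypothesis.Theorems.IntegerScrewRung512
import HarnessLib

/-!
# Splittings — screw bridge, FIRST RUNGS of the two open residuals R2 (`FozNonsingular`) and R3 (`IndexTransfer`):
# `RH ⟺ n₋ ≡ 0`, the `K = 0` rung of index transfer, the frozen-or-unbounded trichotomy, the certified rung `n ≤ 511`,
# and «R3 ⟸ Lemma U» with Lemma U PROVED for at most one off-line zero (zero-definition delta file)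

Cell rh-split, seat rh-split-screw-bridge g3/g4 (brief sha16 f79c5f09d8bcb036), card `run/shared/lean/pub/rh-split/cards/SPLIT-screw-bridge.md`
§8-U; DELTA-ONLY raw forms of `HOME/rh-split-screw-bridge/ScrewBridgeRawG3.lean` raw v4 (sha16 b1afd1ae53d58c5f, 852 lines) §6 —
exactly what the landed `ScrewBridgeRawG3.lean` (p465620), `IntegerScrewFozIndexBound.lean` (p469353: R1 `fozIndexBound`) and
`ScrewBridgeFozConsequences.lean` (p470283) do not yet carry; filed by rh-split-typer-1 g2 on the lead's GO 2026-08-26T22:51Z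
(rh-split-lead g2: «the kernel CONTROLS of the C6 S-screen and the typed frame of T-R3'»).  With ETAIL, FOZ and the negative
index `n₋(n) = #{i | λ_i(screwMatrix n) < 0}` written out:

* `boundedIndex_of_rh` — RH ⟹ bounded negative index, through FOZ and the landed R1 theorem `fozIndexBound` (cited by name);
* `rh_iff_negIndex_eq_zero` — **RH ⟺ the negative index of every screw matrix is `0`** (→ the tree's strict floor
  `screwMatrix_posDef_of_riemannHypothesis`, ← `S_n ⪰ 0 ∀ n` + `riemannHypothesis_of_screwMatrix_posSemidef`, DiscreteLandau);
* `indexTransfer_rung_zero` — **R3 at `K = 0`** (PROVED rung of index transfer): `n₋ ≡ 0 ⟹ FOZ`;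
  `one_le_negIndex_eventually_of_not_rh` — off RH the negative index is eventually `≥ 1` (first step of PIVOT-LAW's Lemma U);
* `negIndex_frozen_or_unbounded` — the index axis is a trichotomy: `n₋` frozen at some `k` (RH iff `k = 0`) or `n₋ → ∞`;
* `negIndex_eq_zero_of_le_511`, `screwDet_pos_of_le_511` — the CERTIFIED rung of both residuals on `n ≤ 511`
  (tree: `screwMatrix_posDef_of_le_511`, interval arithmetic, standard axioms);
* `indexTransfer_of_indexLowerBound` — **R3 ⟸ the typed Lemma U «IndexLowerBound»** (every finite set of off-line zeros is
  eventually matched by as many negative eigenvalues); `indexLowerBound_of_card_le_one` — **Lemma U holds for `#F ≤ 1`**;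
  what remains of R3 is the COUNT for `q ≥ 2` off-line zeros (T-R3').

Label (lead g2 22:06Z/22:51Z; referee g2 pre-file requested): class of the row UNCHANGED (barrier-note; the ∃-tail door is the
FOZ costume); these are RH-free rungs / certified controls, not a splitting with teeth.  Typer replay (rh-split-typer-1 g2):
farm rc 0, 0 warnings, 0 sorry, std axioms on `rh_iff_negIndex_eq_zero`, `indexTransfer_of_indexLowerBound`.

HONEST LABEL: SPLITTING SEARCH over kernel-typed RH-EQUIVALENCES; a splitting A ∧ B ⟹ RH is CONDITIONAL bookkeeping unless
A and B are both proved; nothing here bears on the truth of RH.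
-/

set_option linter.dupNamespace false

noncomputable section

namespace Summit.RiemannHypothesis.RiemannHypothesis.Theorems.Splittings.ScrewBridgeRungs

open Finset Matrix
open Literature.NumberTheory.LFunctions
open Summit.RiemannHypothesis.RiemannHypothesis.Theses.RuelleBand
open Summit.RiemannHypothesis.RiemannHypothesis.Theorems.IntegerScrew
open Summit.RiemannHypothesis.RiemannHypothesis.Theorems.Splittings.BombieriFozNoDep
open Summit.RiemannHypothesis.RiemannHypothesis.Theorems.Splittings.ScrewBridgeRawG3
open Summit.RiemannHypothesis.RiemannHypothesis.Theorems.IntegerScrew.FozIndexBound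

/-- RH ⟹ bounded negative index, through FOZ (`cofiniteCriticalLine_of_rh`) and the landed R1 theorem `fozIndexBound`.
[folklore] -/
theorem boundedIndex_of_rh (h : _root_.RiemannHypothesis) :
    (∃ K : ℕ, ∀ n : ℕ, (Finset.univ.filter fun i => (screwMatrix_isHermitian n).eigenvalues i < 0).card ≤ K) :=
  fozIndexBound (cofiniteCriticalLine_of_rh h)

/-! ## First rungs of the two open residuals (definition-free)

R3 (index transfer `n₋ bounded ⟹ FOZ`) at `K = 0`: `n₋ ≡ 0` is «every `S_n ⪰ 0`», which the tree's
diagonal detection `riemannHypothesis_of_screwMatrix_posSemidef` (DiscreteLandau) turns into RH, hence FOZ;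
contrapositively, off RH the negative index is eventually `≥ 1`. R2 (eventual nonsingularity) and R3 both
hold on the certified range `n ≤ 511` (`screwMatrix_posDef_of_le_511`, interval arithmetic in the tree). -/

/-- A positive definite screw matrix has negative index `0`. [folklore] -/
theorem negIndex_eq_zero_of_posDef {n : ℕ} (h : (screwMatrix n).PosDef) :
    (Finset.univ.filter fun i => (screwMatrix_isHermitian n).eigenvalues i < 0).card = 0 := by
  rw [Finset.card_eq_zero, Finset.filter_eq_empty_iff]
  intro i _
  exact not_lt.mpr (h.posSemidef.eigenvalues_nonneg i)

/-- Negative index `0` means `S_n ⪰ 0`. [folklore] -/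
theorem posSemidef_of_negIndex_eq_zero {n : ℕ}
    (h : (Finset.univ.filter fun i => (screwMatrix_isHermitian n).eigenvalues i < 0).card = 0) :
    (screwMatrix n).PosSemidef
    := by
  rw [(screwMatrix_isHermitian n).posSemidef_iff_eigenvalues_nonneg]
  intro i
  by_contra hlt
  rw [not_le] at hlt
  rw [Finset.card_eq_zero, Finset.filter_eq_empty_iff] at h
  exact h (Finset.mem_univ i) hlt

/-- **RH ⟺ the negative index of every screw matrix is `0`** (an RH-EQUIVALENCE on the index axis;
→ the tree's strict floor, ← diagonal + DiscreteLandau). [cite: Suzuki2023, Thm 1.2] -/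
theorem rh_iff_negIndex_eq_zero :
    _root_.RiemannHypothesis ↔ ∀ n : ℕ, (Finset.univ.filter fun i => (screwMatrix_isHermitian n).eigenvalues i < 0).card = 0 :=
  ⟨fun h n => negIndex_eq_zero_of_posDef (screwMatrix_posDef_of_riemannHypothesis h n),
    fun h => riemannHypothesis_of_screwMatrix_posSemidef
      (fun n => posSemidef_of_negIndex_eq_zero (h n))⟩

/-- **R3 at `K = 0` (PROVED rung of index transfer)**: identically vanishing negative index ⟹ FOZ
(indeed RH). [folklore] -/
theorem indexTransfer_rung_zero
    (h : ∀ n : ℕ, (Finset.univ.filter fun i => (screwMatrix_isHermitian n).eigenvalues i < 0).card ≤ 0) : CofiniteCriticalLine :=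
  cofiniteCriticalLine_of_rh (rh_iff_negIndex_eq_zero.mpr fun n => Nat.le_zero.mp (h n))

/-- **Off RH the negative index is eventually `≥ 1`** (monotonicity of `n₋` + the `K = 0` rung): the first
step of PIVOT-LAW's Lemma U «each off-line zero eventually forces negative directions». [folklore] -/
theorem one_le_negIndex_eventually_of_not_rh (h : ¬ _root_.RiemannHypothesis) :
    ∃ N : ℕ, ∀ n : ℕ, N ≤ n → 1 ≤ (Finset.univ.filter fun i => (screwMatrix_isHermitian n).eigenvalues i < 0).card := by
  by_contra hcon
  push Not at hcon
  apply h
  rw [rh_iff_negIndex_eq_zero]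
  intro n
  obtain ⟨m, hnm, hm⟩ := hcon n
  have hle := negIndex_mono hnm
  omega

/-- The index axis is a trichotomy: `n₋ ≡ 0` (⟺ RH), or `n₋` freezes at some `k ≥ 1`, or `n₋ → ∞`;
formally: bounded-and-frozen or unbounded. [folklore] -/
theorem negIndex_frozen_or_unbounded :
    (∃ N k : ℕ, ∀ n : ℕ, N ≤ n → (Finset.univ.filter fun i => (screwMatrix_isHermitian n).eigenvalues i < 0).card = k) ∨
      ∀ K : ℕ, ∃ n : ℕ, K < (Finset.univ.filter fun i => (screwMatrix_isHermitian n).eigenvalues i < 0).card := by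
  by_cases hb : ∃ K : ℕ, ∀ n : ℕ, (Finset.univ.filter fun i => (screwMatrix_isHermitian n).eigenvalues i < 0).card ≤ K
  · exact Or.inl (nat_eventually_const_of_monotone_bounded (fun n => (Finset.univ.filter fun i => (screwMatrix_isHermitian n).eigenvalues i < 0).card)
      (fun _ _ hab => negIndex_mono hab) hb)
  · right
    intro K
    by_contra hK
    push Not at hK
    exact hb ⟨K, hK⟩

/-- **Certified rung (both residuals) on `n ≤ 511`**: negative index `0` … [folklore] -/
theorem negIndex_eq_zero_of_le_511 {n : ℕ} (hn : n ≤ 511) :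
    (Finset.univ.filter fun i => (screwMatrix_isHermitian n).eigenvalues i < 0).card = 0 :=
  negIndex_eq_zero_of_posDef (screwMatrix_posDef_of_le_511 hn)

/-- … and nonsingularity `screwDet n > 0` for `n ≤ 511`, unconditionally (tree: `screwMatrix_posDef_of_le_511`,
`screwDet_pos_of_posDef`). [folklore] -/
theorem screwDet_pos_of_le_511 {n : ℕ} (hn : n ≤ 511) : 0 < screwDet n :=
  screwDet_pos_of_posDef (screwMatrix_posDef_of_le_511 hn)


/-! ### R3 reduces to the typed Lemma U «IndexLowerBound»; Lemma U holds for at most one off-line zero -/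

/-- **R3′ ⟹ R3**: if every finite set of off-line zeros is eventually matched by as many negative
eigenvalues (PIVOT-LAW Lemma U, typed — the hypothesis `hU`), then a bounded negative index forces FOZ.

ERRATUM (rh-split screw-bridge g4, 2026-08-27; referee g2 approved; no statement change): `hU` as typed
(`F` over ALL off-line zeros, `F.card ≤ n₋`) is unattainable off RH — `n₋ ≤ 2·#{Klein orbits} ≤ #F/2` for `F`
a union of orbits (screw-bridge g4's `negIndex_le_two_mul_card_reps`, `rh_of_foz_of_indexLowerBound`); the
theorem is true and stays as a settled vacuity edge; use `indexTransfer_of_indexLowerBound_two` (`2·n₋`) or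
the representatives form (`n₋ ≥ q`) instead. [folklore] -/
theorem indexTransfer_of_indexLowerBound
    (hU : ∀ F : Finset ZetaZeros.riemannZetaNontrivialZeros, (∀ ρ ∈ F, (ρ : ℂ).re ≠ 1 / 2) →
      ∃ N : ℕ, ∀ n : ℕ, N ≤ n → F.card ≤ (Finset.univ.filter fun i => (screwMatrix_isHermitian n).eigenvalues i < 0).card) :
    (∃ K : ℕ, ∀ n : ℕ, (Finset.univ.filter fun i => (screwMatrix_isHermitian n).eigenvalues i < 0).card ≤ K) → CofiniteCriticalLine := by
  rintro ⟨K, hK⟩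
  by_contra hS
  have hpre : (Subtype.val ⁻¹'
      {s : ℂ | riemannZeta s = 0 ∧ 0 < s.re ∧ s.re < 1 ∧ s.re ≠ 1 / 2} :
        Set ZetaZeros.riemannZetaNontrivialZeros).Infinite := by
    intro hfin
    apply hS
    have himg := hfin.image (Subtype.val : ZetaZeros.riemannZetaNontrivialZeros → ℂ)
    refine himg.subset ?_
    intro s hs
    exact ⟨⟨s, ZetaZeros.riemannZetaNontrivialZeros.mem_iff'.2 ⟨hs.1, hs.2.1, hs.2.2.1⟩⟩, hs, rfl⟩
  obtain ⟨F, hFsub, hFcard⟩ := hpre.exists_subset_card_eq (K + 1)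
  have hoff : ∀ ρ ∈ F, (ρ : ℂ).re ≠ 1 / 2 := by
    intro ρ hρ
    have hρS : riemannZeta (ρ : ℂ) = 0 ∧ 0 < (ρ : ℂ).re ∧ (ρ : ℂ).re < 1 ∧ (ρ : ℂ).re ≠ 1 / 2 :=
      hFsub (Finset.mem_coe.mpr hρ)
    exact hρS.2.2.2
  obtain ⟨N, hN⟩ := hU F hoff
  have h1 := hN N le_rfl
  have h2 := hK N
  omega

/-- An off-line non-trivial zero refutes RH (bookkeeping for the next lemma). [folklore] -/
theorem not_rh_of_offLine (ρ : ZetaZeros.riemannZetaNontrivialZeros) (hρ : (ρ : ℂ).re ≠ 1 / 2) :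
    ¬ _root_.RiemannHypothesis := by
  intro hRH
  obtain ⟨hz, h0, h1⟩ := ZetaZeros.riemannZetaNontrivialZeros.mem_iff'.1 ρ.2
  refine hρ (hRH (ρ : ℂ) hz ?_ ?_)
  · rintro ⟨k, hk⟩
    have hre : (ρ : ℂ).re = -2 * ((k : ℝ) + 1) := by
      rw [hk]; simp
    have hk0 : (0 : ℝ) ≤ k := Nat.cast_nonneg k
    linarith
  · intro h1eq
    rw [h1eq, Complex.one_re] at h1
    exact lt_irrefl _ h1

/-- **Lemma U for at most one off-line zero is a theorem** (`#F ≤ 1`): by `one_le_negIndex_eventually_of_not_rh`.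
What Lemma U needs beyond this is the COUNT (q distinct off-line zeros ⟹ q negative directions).
[folklore] -/
theorem indexLowerBound_of_card_le_one (F : Finset ZetaZeros.riemannZetaNontrivialZeros)
    (hF : ∀ ρ ∈ F, (ρ : ℂ).re ≠ 1 / 2) (h1 : F.card ≤ 1) :
    ∃ N : ℕ, ∀ n : ℕ, N ≤ n → F.card ≤ (Finset.univ.filter fun i => (screwMatrix_isHermitian n).eigenvalues i < 0).card := by
  by_cases h0 : F.card = 0
  · exact ⟨0, fun n _ => by rw [h0]; exact Nat.zero_le _⟩
  · have hc : F.card = 1 := by omega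
    obtain ⟨ρ, hρF⟩ := Finset.card_pos.mp (by omega : 0 < F.card)
    obtain ⟨N, hN⟩ := one_le_negIndex_eventually_of_not_rh (not_rh_of_offLine ρ (hF ρ hρF))
    exact ⟨N, fun n hn => hc ▸ hN n hn⟩

end Summit.RiemannHypothesis.RiemannHypothesis.Theorems.Splittings.ScrewBridgeRungs

end
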